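import Mathlib
import HarnessLib
import Summits.MatrixMultiplication.MatrixMultiplication.Theorems.OutsiderSandwichSymmetricCore
import Summits.MatrixMultiplication.MatrixMultiplication.Theorems.OutsiderSandwichGluingExtremal
import Summits.MatrixMultiplication.MatrixMultiplication.Theorems.OutsiderSandwichExchangeLevelTwo
import Summits.MatrixMultiplication.MatrixMultiplication.Theorems.OutsiderSandwichBlockOne
import Summits.MatrixMultiplication.MatrixMultiplication.Theorems.OutsiderSandwichLaserFloorCut

/-!
# Outsider sandwich — THE MINIMAL CRIMINAL EXISTS: the least entangled level `N⋆`, the two-copies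
# regime, and the extremal face `θ⋆ = ω − 2` (decomp-mm lens-4 «minimal counterexample», g24)

Beneath the aside leaf `BlockOneIsMM` (item 27147, `⟨2,2,2⟩ ≲ C₁ ⟺ θ⋆ = 0`); the cut of record
(`LaserTangency ∧ LaserMergeOptimal`) is untouched.  `Helped N B ⟺ ⟨B⟩ ⊠ C₁^{⊠N} ⊵ ⟨2,2,2⟩^{⊠N}`,
`r(N) = exchangeNumber N`, `θ⋆ = exchangeExponent`, `SymHelped` = g23's symmetric-core certificates
(floor `4^N ≤ B·3^N`).

1. **The least entangled level.** `CoreBeaten N :⟺ ∃ B, Helped N B ∧ B·3^N < 4^N ⟺ r(N)·3^N < 4^N ⟺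
   Helped N ⌊(4^N−1)/3^N⌋`.  By g23's forcing (Le Gall, `θ⋆ < 2/5 < log₂(4/3)`) core-beaten levels
   exist (all large ones are), so the LEAST one **`N⋆ := coreBeatLevel`** is a well-defined integer with
   **`3 ≤ N⋆`** (`r(1) = r(2) = 2`), and the cheapest certificate at `N⋆` is NOT a core certificate
   (`not_symHelped_exchangeNumber_coreBeatLevel`).  Census dictionary: `N⋆ = 3 ⟺ Helped 3 2`,
   `N⋆ = 4 ⟺ ¬Helped 3 2 ∧ Helped 4 3`, ceilings `2,3,4,5,7,9` for `N = 3…8` (`coreBeaten_table`).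
2. **Bounded exchange.** `(∃ C, ∀ N ≥ 1, Helped N C) ⟹ BlockOneIsMM` — in particular `r ≡ 2 ⟹` leaf;
   pointwise floor **`2^{θ⋆N} ≤ r(N)` for EVERY `N`** (attainment, g21), so one level with
   `r(N) < 2^{θN}` gives `θ⋆ < θ`; the two-copies dichotomy: `r ≡ 2` on `N ≥ 1`, or a least `M⋆ ≥ 3`
   has `r(M⋆) ≥ 3`.
3. **The extremal face.** Pointwise `logRatio F ≤ log₂F⟨2,2,2⟩ − 2 ≤ ω − 2`, equality in the first iff
   `F(C₁) = 4 = Q̃(C₁)` (`F` is `C₁`-NULL).  Hence **`θ⋆ = ω − 2 ⟺ ∃` a universal top point that is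
   `C₁`-null** (`diagonalOptimal_iff_exists_null`); `DiagonalOptimal :⟺ θ⋆ = ω − 2` is necessary,
   implies the residual `BlockOneMergeOptimal`, and **`ω = 2 ⟺ θ⋆ = 0 ∧ θ⋆ = ω − 2 ⟺
   BlockOneTangency ∧ DiagonalOptimal`**: the summit says the window `θ⋆ ∈ [0, ω − 2]` is degenerate,
   its upper end being the leaf and its lower end diagonal-optimality.

[Strassen1988, Thm. 2.3, Thm. 3.8]; [LeGall2014, Table 2]; [ChristandlVranaZuiddam2023, Example 1.4,
Prop. 1.6]; [Blaser2013, Thm. 6.3]; [Strassen1991, Thm. 6.1]; [AlmanLi2026, Prop. 4.2].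
-/

noncomputable section

open Literature.Computability.AlgebraicComplexity
open Summit.MatrixMultiplication.MatrixMultiplication.Theorems.OutsiderSandwichCoupling (coupling₁)
open Summit.MatrixMultiplication.MatrixMultiplication.Theorems.OutsiderSandwichEdgeRigidity
  (four_le_map_matMulTensor_two)
open Summit.MatrixMultiplication.MatrixMultiplication.Theorems.OutsiderSandwichExchangeRate
open Summit.MatrixMultiplication.MatrixMultiplication.Theorems.OutsiderSandwichExchangeExponent
open Summit.MatrixMultiplication.MatrixMultiplication.Theorems.OutsiderSandwichExchangeSpectral
open Summit.MatrixMultiplication.MatrixMultiplication.Theorems.OutsiderSandwichExchangeLevelTwo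
  (exchangeNumber_two)
open Summit.MatrixMultiplication.MatrixMultiplication.Theorems.OutsiderSandwichSymmetricCore
  (SymHelped not_symHelped_of_lt eventually_forcing)
open Summit.MatrixMultiplication.MatrixMultiplication.Theorems.OutsiderSandwichBlock
  (map_matMulTensor_pos)
open Summit.MatrixMultiplication.MatrixMultiplication.Theorems.OutsiderSandwichGluingGain
  (logRatio_eq_logb_sub map_coupling₁_pos)
open Summit.MatrixMultiplication.MatrixMultiplication.Theorems.OutsiderSandwichGluingExtremal
  (exists_extremal_point)
open Summit.MatrixMultiplication.MatrixMultiplication.Theorems.OutsiderSandwichLaserFloorCut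
  (matExp_le_omega)

namespace Summit.MatrixMultiplication.MatrixMultiplication.Theorems.OutsiderSandwichCoreBeatLevel

/-! ## 1. Core-beaten levels and the least one -/

/-- **`CoreBeaten N`** (problem-side definition): some level-`N` certificate is strictly cheaper than
the symmetric-core floor `(4/3)^N`: `∃ B, Helped N B ∧ B·3^N < 4^N`. -/
def CoreBeaten (N : ℕ) : Prop :=
  ∃ B : ℕ, Helped N B ∧ B * 3 ^ N < 4 ^ N

/-- The core ceiling `⌊(4^N − 1)/3^N⌋` — the largest `B` with `B·3^N < 4^N` (problem-side definition). -/
def coreCeiling (N : ℕ) : ℕ :=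
  (4 ^ N - 1) / 3 ^ N

/-- `B·3^N < 4^N ⟺ B ≤ ⌊(4^N − 1)/3^N⌋`. [folklore] -/
theorem mul_lt_iff_le_coreCeiling {N B : ℕ} : B * 3 ^ N < 4 ^ N ↔ B ≤ coreCeiling N := by
  rw [coreCeiling, Nat.le_div_iff_mul_le (pow_pos (by norm_num) N),
    Nat.lt_iff_le_pred (pow_pos (by norm_num) N)]

/-- `CoreBeaten N ⟺ Helped N ⌊(4^N − 1)/3^N⌋`. [cite: ChristandlVranaZuiddam2023, Example 1.4] -/
theorem coreBeaten_iff (N : ℕ) : CoreBeaten N ↔ Helped N (coreCeiling N) :=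
  ⟨fun ⟨_, hB, hlt⟩ => helped_mono hB (mul_lt_iff_le_coreCeiling.1 hlt),
    fun h => ⟨_, h, mul_lt_iff_le_coreCeiling.2 le_rfl⟩⟩

/-- `CoreBeaten N ⟺ r(N)·3^N < 4^N`. [cite: ChristandlVranaZuiddam2023, Example 1.4] -/
theorem coreBeaten_iff_exchangeNumber (N : ℕ) : CoreBeaten N ↔ exchangeNumber N * 3 ^ N < 4 ^ N := by
  rw [coreBeaten_iff, helped_iff_exchangeNumber_le, mul_lt_iff_le_coreCeiling]

/-- **The census table**: `CoreBeaten N` for `N = 3 … 8` is the finite restriction problem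
`Helped N B` at `(N, B) = (3,2), (4,3), (5,4), (6,5), (7,7), (8,9)`. [folklore] -/
theorem coreBeaten_table :
    (CoreBeaten 3 ↔ Helped 3 2) ∧ (CoreBeaten 4 ↔ Helped 4 3) ∧ (CoreBeaten 5 ↔ Helped 5 4) ∧
      (CoreBeaten 6 ↔ Helped 6 5) ∧ (CoreBeaten 7 ↔ Helped 7 7) ∧ (CoreBeaten 8 ↔ Helped 8 9) := by
  refine ⟨?_, ?_, ?_, ?_, ?_, ?_⟩ <;> rw [coreBeaten_iff] <;> simp [coreCeiling]

/-- At a positive level whose ceiling is `≤ 1` nothing is core-beaten (`Helped N B ⟹ B ≥ 2`).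
[cite: Blaser2013, Thm. 6.3] -/
theorem not_coreBeaten_of_coreCeiling_le_one {N : ℕ} (hN : 1 ≤ N) (hc : coreCeiling N ≤ 1) :
    ¬ CoreBeaten N := by
  rw [coreBeaten_iff]
  intro h
  have h2 := two_le_of_helped hN h
  omega

/-- Level `0` is not core-beaten. [folklore] -/
theorem not_coreBeaten_zero : ¬ CoreBeaten 0 := by
  rw [coreBeaten_iff, show coreCeiling 0 = 0 by simp [coreCeiling]]
  exact not_helped_zero 0

/-- Level `1` is not core-beaten (`r(1) = 2 > 4/3`). [cite: Blaser2013, Thm. 6.3] -/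
theorem not_coreBeaten_one : ¬ CoreBeaten 1 :=
  not_coreBeaten_of_coreCeiling_le_one le_rfl (by simp [coreCeiling])

/-- Level `2` is not core-beaten (`r(2) = 2 > 16/9`). [cite: Blaser2013, Thm. 6.3] -/
theorem not_coreBeaten_two : ¬ CoreBeaten 2 :=
  not_coreBeaten_of_coreCeiling_le_one (by norm_num) (by simp [coreCeiling])

/-- **Core-beaten levels exist** (g23 forcing from Le Gall's `ω < 2.3729`). [cite: LeGall2014, Table 2] -/
theorem exists_coreBeaten : ∃ N : ℕ, CoreBeaten N := by
  obtain ⟨N₀, h⟩ := eventually_forcing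
  obtain ⟨B, hB, hlt, -⟩ := h N₀ le_rfl
  exact ⟨N₀, B, hB, hlt⟩

/-- All large levels are core-beaten. [cite: LeGall2014, Table 2] -/
theorem eventually_coreBeaten : ∃ N₀ : ℕ, ∀ N : ℕ, N₀ ≤ N → CoreBeaten N := by
  obtain ⟨N₀, h⟩ := eventually_forcing
  exact ⟨N₀, fun N hN => let ⟨B, hB, hlt, _⟩ := h N hN; ⟨B, hB, hlt⟩⟩

open scoped Classical in
/-- **`N⋆ := coreBeatLevel`** (problem-side definition), the LEAST level at which some certificate for
the leaf is strictly cheaper than every symmetric-core certificate — the minimal criminal against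
core-optimality; it exists by `exists_coreBeaten`. -/
def coreBeatLevel : ℕ :=
  Nat.find exists_coreBeaten

open scoped Classical in
/-- `N⋆` is core-beaten. [cite: LeGall2014, Table 2] -/
theorem coreBeaten_coreBeatLevel : CoreBeaten coreBeatLevel :=
  Nat.find_spec exists_coreBeaten

open scoped Classical in
/-- Minimality: every core-beaten level is `≥ N⋆`. [folklore] -/
theorem coreBeatLevel_le_of_coreBeaten {N : ℕ} (h : CoreBeaten N) : coreBeatLevel ≤ N :=
  Nat.find_min' exists_coreBeaten h

open scoped Classical in
/-- Minimality: no level below `N⋆` is core-beaten. [folklore] -/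
theorem not_coreBeaten_of_lt_coreBeatLevel {N : ℕ} (h : N < coreBeatLevel) : ¬ CoreBeaten N :=
  Nat.find_min exists_coreBeaten h

open scoped Classical in
/-- `N⋆ = N ⟺ N` is core-beaten and no smaller level is. [folklore] -/
theorem coreBeatLevel_eq_iff {N : ℕ} :
    coreBeatLevel = N ↔ CoreBeaten N ∧ ∀ M : ℕ, M < N → ¬ CoreBeaten M :=
  Nat.find_eq_iff exists_coreBeaten

/-- **`3 ≤ N⋆`.** [cite: Blaser2013, Thm. 6.3] -/
theorem three_le_coreBeatLevel : 3 ≤ coreBeatLevel := by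
  by_contra h
  have hc := coreBeaten_coreBeatLevel
  obtain h0 | h1 | h2 : coreBeatLevel = 0 ∨ coreBeatLevel = 1 ∨ coreBeatLevel = 2 := by omega
  exacts [not_coreBeaten_zero (h0 ▸ hc), not_coreBeaten_one (h1 ▸ hc), not_coreBeaten_two (h2 ▸ hc)]

/-- Below `N⋆` every certificate costs at least the core floor: `N < N⋆ ⟹ 4^N ≤ r(N)·3^N`. [folklore] -/
theorem floor_le_of_lt_coreBeatLevel {N : ℕ} (h : N < coreBeatLevel) : 4 ^ N ≤ exchangeNumber N * 3 ^ N :=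
  not_lt.1 fun hlt => not_coreBeaten_of_lt_coreBeatLevel h ((coreBeaten_iff_exchangeNumber N).2 hlt)

/-- At `N⋆` the cheapest certificate beats the floor: `r(N⋆)·3^{N⋆} < 4^{N⋆}`. [cite: LeGall2014, Table 2] -/
theorem exchangeNumber_coreBeatLevel_lt : exchangeNumber coreBeatLevel * 3 ^ coreBeatLevel < 4 ^ coreBeatLevel :=
  (coreBeaten_iff_exchangeNumber _).1 coreBeaten_coreBeatLevel

/-- **Entanglement at `N⋆`**: the cheapest certificate at the least entangled level is NOT a
symmetric-core certificate. [cite: ChristandlVranaZuiddam2023, Example 1.4] -/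
theorem not_symHelped_exchangeNumber_coreBeatLevel : ¬ SymHelped coreBeatLevel (exchangeNumber coreBeatLevel) :=
  not_symHelped_of_lt exchangeNumber_coreBeatLevel_lt

/-- **`N⋆ = 3 ⟺ Helped 3 2`** (`⟨2⟩ ⊠ C₁^{⊠3} ⊵ ⟨8,8,8⟩`, the census's `(3,2)` problem).
[cite: LeGall2014, Table 2] -/
theorem coreBeatLevel_eq_three_iff : coreBeatLevel = 3 ↔ Helped 3 2 := by
  rw [← coreBeaten_table.1]
  exact ⟨fun h => h ▸ coreBeaten_coreBeatLevel,
    fun h => le_antisymm (coreBeatLevel_le_of_coreBeaten h) three_le_coreBeatLevel⟩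

/-- `¬Helped 3 2 ⟹ 4 ≤ N⋆`. [folklore] -/
theorem four_le_coreBeatLevel_of_not_helped (h : ¬ Helped 3 2) : 4 ≤ coreBeatLevel :=
  three_le_coreBeatLevel.eq_or_lt.elim (fun h3 => absurd (coreBeatLevel_eq_three_iff.1 h3.symm) h) id

/-- **`N⋆ = 4 ⟺ ¬Helped 3 2 ∧ Helped 4 3`.** [cite: LeGall2014, Table 2] -/
theorem coreBeatLevel_eq_four_iff : coreBeatLevel = 4 ↔ ¬ Helped 3 2 ∧ Helped 4 3 := by
  rw [← coreBeaten_table.1, ← coreBeaten_table.2.1]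
  exact ⟨fun h => ⟨not_coreBeaten_of_lt_coreBeatLevel (by omega), h ▸ coreBeaten_coreBeatLevel⟩,
    fun ⟨h3, h4⟩ => le_antisymm (coreBeatLevel_le_of_coreBeaten h4)
      (four_le_coreBeatLevel_of_not_helped fun h => h3 (coreBeaten_table.1.2 h))⟩

/-! ## 2. The two-copies regime and bounded exchange -/

/-- **Bounded exchange achieves every positive rate**: if `C` copies help at every level `N ≥ 1`,
then `ExponentAchieved θ` for every `θ > 0`. [cite: Strassen1988, Thm. 3.8] -/
theorem exponentAchieved_of_bounded {C : ℕ} (h : ∀ N : ℕ, 1 ≤ N → Helped N C) {θ : ℝ} (hθ : 0 < θ) :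
    ExponentAchieved θ := by
  intro N₀
  have hC : (0 : ℝ) < C := by
    have := two_le_of_helped le_rfl (h 1 le_rfl)
    exact_mod_cast (by omega : 0 < C)
  obtain ⟨K, hK⟩ : ∃ K : ℕ, Real.logb 2 C / θ ≤ K := ⟨_, Nat.le_ceil _⟩
  set N : ℕ := max (max N₀ 1) K with hNdef
  refine ⟨N, (le_max_left _ _).trans (le_max_left _ _), C,
    h N ((le_max_right _ _).trans (le_max_left _ _)), ?_⟩
  have hKN : (K : ℝ) ≤ N := by exact_mod_cast le_max_right _ _
  have hK' : Real.logb 2 C ≤ K * θ := (div_le_iff₀ hθ).1 hK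
  have hlog : Real.logb 2 C ≤ θ * N := by nlinarith
  calc (C : ℝ) = (2 : ℝ) ^ Real.logb 2 (C : ℝ) := (Real.rpow_logb (by norm_num) (by norm_num) hC).symm
    _ ≤ (2 : ℝ) ^ (θ * N) := Real.rpow_le_rpow_of_exponent_le (by norm_num) hlog

/-- **`(∃ C, ∀ N ≥ 1, Helped N C) ⟹ BlockOneIsMM`**: a bounded number of helping copies at every level
proves the leaf. [cite: Strassen1988, Thm. 3.8] -/
theorem blockOneIsMM_of_bounded {C : ℕ} (h : ∀ N : ℕ, 1 ≤ N → Helped N C) :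
    Theses.OutsiderSandwich.BlockOneIsMM :=
  blockOneIsMM_iff_forall_exponentAchieved.2 fun _ hθ => exponentAchieved_of_bounded h hθ

/-- In particular **`(∀ N ≥ 1, Helped N 2) ⟹ BlockOneIsMM`**: if two copies always suffice (as at
levels `1, 2`), the leaf holds. [cite: Strassen1988, Thm. 3.8] -/
theorem blockOneIsMM_of_forall_helped_two (h : ∀ N : ℕ, 1 ≤ N → Helped N 2) :
    Theses.OutsiderSandwich.BlockOneIsMM :=
  blockOneIsMM_of_bounded h

/-- Contrapositive: a counterexample to the leaf makes `r(N)` unbounded. [cite: Strassen1988, Thm. 3.8] -/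
theorem exchangeNumber_unbounded_of_not_blockOneIsMM (h : ¬ Theses.OutsiderSandwich.BlockOneIsMM) (C : ℕ) :
    ∃ N : ℕ, 1 ≤ N ∧ C < exchangeNumber N := by
  by_contra hc
  push Not at hc
  exact h (blockOneIsMM_of_bounded fun N hN => helped_mono (helped_exchangeNumber N) (hc N hN))

/-- **Pointwise floor from the extremal point: `2^{θ⋆·N} ≤ r(N)` for EVERY `N`** (g21 attainment:
some universal `F⋆` has `F⋆⟨2,2,2⟩/F⋆(C₁) = 2^{θ⋆}`, and `(F⟨2,2,2⟩/F(C₁))^N ≤ r(N)`).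
[cite: Strassen1988, Thm. 2.3] -/
theorem rpow_le_exchangeNumber (N : ℕ) : (2 : ℝ) ^ (exchangeExponent * N) ≤ exchangeNumber N := by
  obtain ⟨F, hF, hFe⟩ := exists_extremal_point
  have hC := map_coupling₁_pos hF
  have hM := map_matMulTensor_pos hF
  have hq : (2 : ℝ) ^ exchangeExponent = F (matMulTensor ℂ 2 2 2) / F coupling₁ := by
    rw [← hFe, logRatio, Real.rpow_logb (by norm_num) (by norm_num) (div_pos hM hC)]
  rw [Real.rpow_mul_natCast (by norm_num), hq]
  exact ratio_pow_le_exchangeNumber N hF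

/-- Hence a single level with `r(N) < 2^{θN}` bounds the exchange exponent STRICTLY: `θ⋆ < θ`.
[cite: Strassen1988, Thm. 2.3] -/
theorem exchangeExponent_lt_of_level {N : ℕ} (hN : 1 ≤ N) {θ : ℝ}
    (h : (exchangeNumber N : ℝ) < (2 : ℝ) ^ (θ * N)) : exchangeExponent < θ := by
  have h1 := (rpow_le_exchangeNumber N).trans_lt h
  have hN' : (0 : ℝ) < N := by exact_mod_cast hN
  have h2 := (Real.rpow_lt_rpow_left_iff (by norm_num : (1 : ℝ) < 2)).1 h1
  nlinarith

/-- **The two-copies dichotomy**: either `r(N) = 2` for all `N ≥ 1` (and then the leaf holds), or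
there is a least level `M⋆ ≥ 3` with `r(M⋆) ≥ 3`, below which `r = 2`. [cite: Blaser2013, Thm. 6.3] -/
theorem twoCopies_dichotomy :
    (∀ N : ℕ, 1 ≤ N → exchangeNumber N = 2) ∨
      ∃ M : ℕ, 3 ≤ M ∧ 3 ≤ exchangeNumber M ∧ ∀ N : ℕ, 1 ≤ N → N < M → exchangeNumber N = 2 := by
  classical
  by_cases h : ∀ N : ℕ, 1 ≤ N → exchangeNumber N = 2
  · exact Or.inl h
  · right
    push Not at h
    have hex : ∃ M : ℕ, 1 ≤ M ∧ exchangeNumber M ≠ 2 := h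
    refine ⟨Nat.find hex, ?_, ?_, ?_⟩
    · obtain ⟨h1, hne⟩ := Nat.find_spec hex
      have hn1 : Nat.find hex ≠ 1 := fun e => hne (by rw [e]; exact exchangeNumber_one)
      have hn2 : Nat.find hex ≠ 2 := fun e => hne (by rw [e]; exact exchangeNumber_two)
      omega
    · obtain ⟨h1, hne⟩ := Nat.find_spec hex
      have h2 := two_le_exchangeNumber h1
      omega
    · intro N hN hlt
      have := Nat.find_min hex hlt
      push Not at this
      exact this hN

/-- The first branch proves the leaf. [cite: Strassen1988, Thm. 3.8] -/
theorem blockOneIsMM_of_forall_exchangeNumber_eq_two (h : ∀ N : ℕ, 1 ≤ N → exchangeNumber N = 2) :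
    Theses.OutsiderSandwich.BlockOneIsMM :=
  blockOneIsMM_of_forall_helped_two fun N hN => (h N hN) ▸ helped_exchangeNumber N

/-! ## 3. The extremal face: `θ⋆ = ω − 2` iff a top point is `C₁`-null -/

variable {F : SpectralMap ℂ}

/-- `2 ≤ log₂ F(C₁)` at every universal point. [cite: Strassen1991, Thm. 6.1] -/
theorem two_le_logb_map_coupling₁ (hF : IsUniversalSpectralPoint ℂ F) : 2 ≤ Real.logb 2 (F coupling₁) := by
  rw [Real.le_logb_iff_rpow_le (by norm_num) (map_coupling₁_pos hF)]
  norm_num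
  exact four_le_map_coupling₁ hF

/-- `log₂ F(C₁) = 2 ⟺ F(C₁) = 4`. [cite: Strassen1991, Thm. 6.1] -/
theorem logb_map_coupling₁_eq_two_iff (hF : IsUniversalSpectralPoint ℂ F) :
    Real.logb 2 (F coupling₁) = 2 ↔ F coupling₁ = 4 := by
  refine ⟨fun h => ?_, fun h => by
    rw [h, show (4 : ℝ) = 2 ^ (2 : ℝ) by norm_num, Real.logb_rpow (by norm_num) (by norm_num)]⟩
  have := Real.rpow_logb (by norm_num : (0 : ℝ) < 2) (by norm_num) (map_coupling₁_pos hF)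
  rw [h] at this
  norm_num at this
  exact this.symm

/-- **Pointwise: `logRatio F ≤ log₂F⟨2,2,2⟩ − 2`.** [cite: Strassen1991, Thm. 6.1] -/
theorem logRatio_le_logb_sub_two (hF : IsUniversalSpectralPoint ℂ F) :
    logRatio F ≤ Real.logb 2 (F (matMulTensor ℂ 2 2 2)) - 2 := by
  rw [logRatio_eq_logb_sub hF]
  linarith [two_le_logb_map_coupling₁ hF]

/-- **… with equality iff `F` is `C₁`-null (`F(C₁) = 4 = Q̃(C₁)`).** [cite: Strassen1991, Thm. 6.1] -/
theorem logRatio_eq_logb_sub_two_iff (hF : IsUniversalSpectralPoint ℂ F) :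
    logRatio F = Real.logb 2 (F (matMulTensor ℂ 2 2 2)) - 2 ↔ F coupling₁ = 4 := by
  rw [logRatio_eq_logb_sub hF, ← logb_map_coupling₁_eq_two_iff hF]
  constructor <;> intro h <;> linarith

/-- **Pointwise: `logRatio F ≤ ω − 2`.** [cite: AlmanLi2026, Prop. 4.2] -/
theorem logRatio_le_omega_sub_two (hF : IsUniversalSpectralPoint ℂ F) : logRatio F ≤ omega ℂ - 2 := by
  linarith [logRatio_le_logb_sub_two hF, matExp_le_omega hF]

/-- **`logRatio F = ω − 2 ⟺ F` is a TOP point (`log₂F⟨2,2,2⟩ = ω`) AND `C₁`-null (`F(C₁) = 4`).**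
[cite: AlmanLi2026, Prop. 4.2] -/
theorem logRatio_eq_omega_sub_two_iff (hF : IsUniversalSpectralPoint ℂ F) :
    logRatio F = omega ℂ - 2 ↔ Real.logb 2 (F (matMulTensor ℂ 2 2 2)) = omega ℂ ∧ F coupling₁ = 4 := by
  rw [← logb_map_coupling₁_eq_two_iff hF, logRatio_eq_logb_sub hF]
  have h1 := matExp_le_omega hF
  have h2 := two_le_logb_map_coupling₁ hF
  exact ⟨fun h => ⟨by linarith, by linarith⟩, fun ⟨h3, h4⟩ => by linarith⟩

/-- **`DiagonalOptimal :⟺ θ⋆ = ω − 2`** (a problem-side definition, the lower piece of the window;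
not a literature fact) — "the diagonal exchange `C₁^{⊠N} ⊵ ⟨4^{N(1−o(1))}⟩` is optimal: nothing cashes
the coupled block for matrix products at a better rate". -/
def DiagonalOptimal : Prop :=
  exchangeExponent = omega ℂ - 2

/-- **THE EXTREMAL FACE: `θ⋆ = ω − 2 ⟺ ∃` a universal top point that is `C₁`-null.**
(`⇐`: such a point has `logRatio = ω − 2 ≥ θ⋆`; `⇒`: the extremal point of g21 has `logRatio = θ⋆ = ω − 2`.)
[cite: Strassen1988, Thm. 2.3] -/
theorem diagonalOptimal_iff_exists_null :
    DiagonalOptimal ↔ ∃ F : SpectralMap ℂ, IsUniversalSpectralPoint ℂ F ∧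
      Real.logb 2 (F (matMulTensor ℂ 2 2 2)) = omega ℂ ∧ F coupling₁ = 4 := by
  refine ⟨fun h => ?_, fun ⟨F, hF, hτ, h4⟩ => le_antisymm exchangeExponent_le_omega_sub_two
    (((logRatio_eq_omega_sub_two_iff hF).2 ⟨hτ, h4⟩) ▸ logRatio_le_exchangeExponent hF)⟩
  obtain ⟨F, hF, hFe⟩ := exists_extremal_point
  exact ⟨F, hF, (logRatio_eq_omega_sub_two_iff hF).1 (hFe.trans h)⟩

/-- `ω = 2 ⟹ DiagonalOptimal` (then `θ⋆ = 0 = ω − 2`): the lower piece is NECESSARY.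
[cite: Strassen1988, Thm. 3.8] -/
theorem diagonalOptimal_of_summit (hS : _root_.MatrixMultiplication) : DiagonalOptimal := by
  rw [DiagonalOptimal, exchangeExponent_eq_zero_of_summit hS]
  have : omega ℂ = 2 := hS
  rw [this]; norm_num

/-- **`DiagonalOptimal ⟹ BlockOneMergeOptimal`** (the residual of the one-block cut): a `C₁`-null top
point has `F(C₁) = 4 ≤ F⟨2,2,2⟩`. [cite: Strassen1988, Thm. 2.3] -/
theorem blockOneMergeOptimal_of_diagonalOptimal (h : DiagonalOptimal) :
    Theses.OutsiderSandwich.BlockOneMergeOptimal := by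
  obtain ⟨F, hF, hτ, h4⟩ := diagonalOptimal_iff_exists_null.1 h
  exact ⟨F, hF, hτ, h4 ▸ four_le_map_matMulTensor_two hF⟩

/-- **THE WINDOW COLLAPSE: `ω = 2 ⟺ θ⋆ = 0 ∧ θ⋆ = ω − 2`** — the summit says the a-priori window
`θ⋆ ∈ [0, ω − 2]` is degenerate; its upper end is the leaf `BlockOneIsMM`, its lower end
`DiagonalOptimal`. [cite: Strassen1988, Thm. 3.8] -/
theorem summit_iff_window :
    _root_.MatrixMultiplication ↔ exchangeExponent = 0 ∧ DiagonalOptimal := by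
  refine ⟨fun hS => ⟨exchangeExponent_eq_zero_of_summit hS, diagonalOptimal_of_summit hS⟩, ?_⟩
  rintro ⟨h0, hd⟩
  rw [DiagonalOptimal, h0] at hd
  show omega ℂ = 2
  linarith

/-- The same with the leaf by name: `ω = 2 ⟺ BlockOneIsMM ∧ DiagonalOptimal`. [cite: Strassen1988, Thm. 3.8] -/
theorem summit_iff_blockOneIsMM_and_diagonalOptimal :
    _root_.MatrixMultiplication ↔ Theses.OutsiderSandwich.BlockOneIsMM ∧ DiagonalOptimal := by
  rw [summit_iff_window, blockOneIsMM_iff_exchangeExponent_eq_zero]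

/-- And with tangency: `ω = 2 ⟺ BlockOneTangency ∧ DiagonalOptimal` (a `C₁`-null top point with
`τ > 2` would violate tangency). [cite: Strassen1988, Thm. 2.3] -/
theorem summit_iff_blockOneTangency_and_diagonalOptimal :
    _root_.MatrixMultiplication ↔ Theses.OutsiderSandwich.BlockOneTangency ∧ DiagonalOptimal :=
  ⟨fun hS => ⟨OutsiderSandwichBlockOne.blockOneTangency_of_summit hS, diagonalOptimal_of_summit hS⟩,
    fun ⟨hT, hD⟩ => OutsiderSandwichBlockOne.summit_of_blockOne hT
      (blockOneMergeOptimal_of_diagonalOptimal hD)⟩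

/-- **In a world with `ω > 2`**: `DiagonalOptimal` fails iff EVERY top point sees matrix-multiplication
content in the block (`F(C₁) > 4`), i.e. iff `θ⋆ < ω − 2`. [cite: Strassen1988, Thm. 2.3] -/
theorem not_diagonalOptimal_iff :
    ¬ DiagonalOptimal ↔ (exchangeExponent < omega ℂ - 2 ∧
      ∀ F : SpectralMap ℂ, IsUniversalSpectralPoint ℂ F →
        Real.logb 2 (F (matMulTensor ℂ 2 2 2)) = omega ℂ → 4 < F coupling₁) := by
  refine ⟨fun h => ⟨lt_of_le_of_ne exchangeExponent_le_omega_sub_two h, fun F hF hτ => ?_⟩,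
    fun ⟨hlt, _⟩ h => absurd h (ne_of_lt hlt)⟩
  exact lt_of_le_of_ne (four_le_map_coupling₁ hF)
    (fun h4 => h (diagonalOptimal_iff_exists_null.2 ⟨F, hF, hτ, h4.symm⟩))

end Summit.MatrixMultiplication.MatrixMultiplication.Theorems.OutsiderSandwichCoreBeatLevel

end
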